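import Literature.MathematicalPhysics.QuantumLattice.PeriodicVariationalPressure
import Literature.MathematicalPhysics.QuantumLattice.FermionGibbsVariationalPrinciple
import HarnessLib

/-!
# The periodic trial state of a superlattice-periodic interaction: the superlattice average of the box-tiling product `⊗_v ρ₀` over an
# ALIGNED box, its mean entropy `≥ S(ρ₀)/N^d` and its cell energy density `= (Re tr(ρ₀H_N) − Re(Ψ∅))/N^d ± col_R(N)S/N^d`

Topic `Literature/MathematicalPhysics/QuantumLattice` (family `hubbard`; crew hubbard-fast S2/S3 «T > 0 for superlattice-periodic models»). The periodic
twin of `FermionBoxTilingTrialState`: for a `q`-periodic interaction `Ψ` the translation-invariant cell average of the tiling state is NOT the right trial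
state (its energy sees an averaged interaction); instead one averages `⊗_v ρ₀` (`boxTilingState N …`, box side `N` a multiple of the periods) only over the
SUPERLATTICE points of `[0,N)^d`:

* §1 `latCell q N = Cell (fun i => N/(q_i+1) − 1)`, `latPos q N k = superlatVec q (pos k)` (the superlattice points of `[0,N)^d`), the decomposition
  `[0,N)^d ≃ Cell q × latCell q N`, `x = pos c + latPos k` (`sum_halfOpenBox_eq_sum_sum`).
* §2 **`InfVolFermionState.perTrialState q N …`** `:= (boxTilingState N …).shiftAverage (latPos q N)`; it is `q`-PERIODIC (`perTrialState_isPeriodic`).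
* §3 ENTROPY: `S(ρ₀)/N^d ≤ s̄(perTrialState)` (`le_entropyDensitySup_perTrialState`; concavity, full-block count, aligned-box limit of `PeriodicStatesMeanEntropy`).
* §4 ENERGY: site energies of translation averages and of superlattice translates (`siteEnergy_shiftAverage`, `IsPeriodic.siteEnergy_shift_superlatVec`),
  `N^d ē_q(perTrialState) = Σ_{x ∈ [0,N)^d} Re ε_{⊗ρ₀}(x)` (`pow_mul_cellMeanEnergy_perTrialState`), hence
  **`|N^d ē_q(perTrialState) − (Re tr(H_{[0,N)^d}ρ₀) − Re(Ψ∅)_{∅∅})| ≤ col_R(N)·S`** (`abs_pow_mul_cellMeanEnergy_perTrialState_sub_le`) for `Ψ` `q`-periodic of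
  finite range `R` with uniform site norm `S`.

Everything is PROVED; definitions with bodies: `latCell`, `latPos`, `cellLatEquiv`, `InfVolFermionState.perTrialState`; no named fact, no number.

## Tree / Mathlib search

REUSED: `boxTilingState`, `boxTilingState_isPeriodic`, `boxTilingState_expect_box_zero`, `pow_mul_le_vonNeumannEntropy_rdm_boxTilingState_shiftSet`,
`le_vonNeumannEntropy_rdm_shiftAverage` (`FermionBoxTiling…`); `Cell`, `cellPos`, `cellRotate`, `cellPos_cellRotate_add`, `shiftAverage(_expect)`,
`shift_shiftAverage`, `IsPeriodic.shift_add_periodVec` (`PeriodicStatesCellAverage`); `superlatVec(_add/_apply)`, `siteEnergy(_apply/_eq_sum_shiftSet)`,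
`cellMeanEnergy`, `cellRes`, `eq_cellPos_cellRes_add_superlatVec`, `prod_div_mul_card_cell`, `norm_sum_siteEnergy_sub_le`, `expect_apply_congr`
(`PeriodicInteractionsCellEnergy`); `IsPeriodic.tendsto_boxEntropyDensity_mul` (`PeriodicStatesMeanEntropy`); `vonNeumannEntropy_rdm_shift`.

## References

* O. Bratteli, D. W. Robinson, *OAQSM 2* (1997), Thm. 6.2.40 (periodic product trial states). [cite: BratteliRobinsonII1997, Thm. 6.2.40]
* R. B. Israel, *Convexity in the Theory of Lattice Gases* (1979), §I.1, Thm. II.2.? (periodic interactions via the sublattice). [cite: Israel1979, Thm. I.2.4]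
* H. Araki, H. Moriya, Rev. Math. Phys. 15 (2003) 93, §8, §11. [cite: ArakiMoriya2003, Theorem 3.8 and §10]
-/

noncomputable section

open scoped ComplexOrder BigOperators Matrix.Norms.L2Operator
open Finset Literature.InformationTheory.Entropy

namespace Literature.MathematicalPhysics.QuantumLattice

open Matrix HubbardWave0 Literature.Probability.LatticeModels ThermodynamicLimit
open _root_.Filter
open scoped _root_.Topology

namespace InfVolFermionState

variable {d : ℕ}

/-! ### §1. Superlattice points of an aligned box -/

/-- The index of the superlattice points in the aligned box `[0,N)^d`: `Π_i Fin (N/(q_i+1))`, written as a `Cell`. [cite: ArakiMoriya2003, §4.1] -/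
abbrev latCell (q : Fin d → ℕ) (N : ℕ) : Type := Cell (fun i => N / (q i + 1) - 1)

/-- **The superlattice point** `(k_i (q_i+1))_i` of `[0,N)^d`. [cite: ArakiMoriya2003, §4.1] -/
def latPos (q : Fin d → ℕ) (N : ℕ) (k : latCell q N) : Site d := superlatVec q (cellPos k)

/-- Coordinates of a superlattice point. [cite: ArakiMoriya2003, §4.1] -/
theorem latPos_apply (q : Fin d → ℕ) (N : ℕ) (k : latCell q N) (i : Fin d) : latPos q N k i = ((k i : ℕ) : ℤ) * ((q i : ℤ) + 1) := rfl

section Aligned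

variable (q : Fin d → ℕ) {N : ℕ} (hN : 1 ≤ N) (hNq : ∀ i, (q i + 1) ∣ N)
include hN hNq

/-- `N/(q_i+1) ≥ 1` for an aligned `N ≥ 1`. [cite: ArakiMoriya2003, §4.1] -/
theorem one_le_div_of_dvd (i : Fin d) : 1 ≤ N / (q i + 1) :=
  Nat.div_pos (Nat.le_of_dvd hN (hNq i)) (Nat.succ_pos _)

/-- `(N/(q_i+1) − 1) + 1 = N/(q_i+1)`. [cite: ArakiMoriya2003, §4.1] -/
theorem div_sub_one_add_one (i : Fin d) : N / (q i + 1) - 1 + 1 = N / (q i + 1) := Nat.sub_add_cancel (one_le_div_of_dvd q hN hNq i)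

/-- **The superlattice points lie in the box** `[0,N)^d`. [cite: ArakiMoriya2003, §4.1] -/
theorem latPos_mem_halfOpenBox (k : latCell q N) : latPos q N k ∈ halfOpenBox d N := by
  rw [mem_halfOpenBox]
  intro i
  have h1 := one_le_div_of_dvd q hN hNq i
  have hk0 := (k i).isLt
  have hk : (k i : ℕ) < N / (q i + 1) := by simp only at hk0; omega
  have hle : ((k i : ℕ) + 1) * (q i + 1) ≤ N :=
    (Nat.mul_le_mul_right _ hk).trans (le_of_eq (Nat.div_mul_cancel (hNq i)))
  rw [latPos_apply]
  constructor
  · positivity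
  · have h := hle
    zify at h
    nlinarith [Int.natCast_nonneg (q i), Int.natCast_nonneg (k i : ℕ)]

/-- **`[0,N)^d ≃ Cell q × latCell q N`**, `x = pos c + latPos k`: every site of the aligned box is uniquely a cell point plus a superlattice point of the box.
[cite: ArakiMoriya2003, §4.1] -/
def cellLatEquiv : Cell q × latCell q N ≃ ↥(halfOpenBox d N) where
  toFun p := ⟨cellPos p.1 + latPos q N p.2, by
    rw [mem_halfOpenBox]
    intro i
    have hc : ((p.1 i : ℕ) : ℤ) ≤ q i := by exact_mod_cast Nat.lt_succ_iff.1 (p.1 i).isLt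
    have h1 := one_le_div_of_dvd q hN hNq i
    have hk0 := (p.2 i).isLt
    have hk : (p.2 i : ℕ) < N / (q i + 1) := by simp only at hk0; omega
    have hle : ((p.2 i : ℕ) + 1) * (q i + 1) ≤ N :=
      (Nat.mul_le_mul_right _ hk).trans (le_of_eq (Nat.div_mul_cancel (hNq i)))
    zify at hle
    simp only [Pi.add_apply, cellPos, latPos_apply]
    constructor
    · positivity
    · nlinarith [Int.natCast_nonneg (q i), Int.natCast_nonneg (p.2 i : ℕ)]⟩
  invFun x := (cellRes q x.1, fun i => ⟨(x.1 i / ((q i : ℤ) + 1)).toNat, by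
    have h1 := one_le_div_of_dvd q hN hNq i
    suffices h : (x.1 i / ((q i : ℤ) + 1)).toNat < N / (q i + 1) by simp only; omega
    have hx := (mem_halfOpenBox.1 x.2) i
    have h0 : (0 : ℤ) < (q i : ℤ) + 1 := by positivity
    obtain ⟨m, hm⟩ := hNq i
    have hq : N / (q i + 1) = m := by rw [hm, Nat.mul_div_cancel_left m (Nat.succ_pos _)]
    rw [hq]
    have hdiv : 0 ≤ x.1 i / ((q i : ℤ) + 1) := Int.ediv_nonneg hx.1 h0.le
    have hn' : (N : ℤ) = ((q i : ℤ) + 1) * m := by rw [hm]; push_cast; ring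
    have hlt : x.1 i / ((q i : ℤ) + 1) < m := (Int.ediv_lt_iff_lt_mul h0).2 (by rw [mul_comm]; linarith [hx.2])
    omega⟩)
  left_inv p := by
    obtain ⟨c, k⟩ := p
    have hc : ∀ i, ((c i : ℕ) : ℤ) < (q i : ℤ) + 1 := fun i => by exact_mod_cast (c i).isLt
    have hres : cellRes q (cellPos c + latPos q N k) = c := by
      funext i
      apply Fin.ext
      simp only [cellRes, Pi.add_apply, cellPos, latPos_apply]
      rw [Int.add_mul_emod_self_right, Int.emod_eq_of_lt (by positivity) (hc i), Int.toNat_natCast]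
    refine Prod.ext hres (funext fun i => Fin.ext ?_)
    have h0 : (0 : ℤ) < (q i : ℤ) + 1 := by positivity
    simp only [Pi.add_apply, cellPos, latPos_apply]
    rw [Int.add_mul_ediv_right _ _ h0.ne', Int.ediv_eq_zero_of_lt (by positivity) (hc i), zero_add, Int.toNat_natCast]
  right_inv x := by
    apply Subtype.ext
    have h := eq_cellPos_cellRes_add_superlatVec q x.1
    show cellPos (cellRes q x.1) + latPos q N _ = x.1
    conv_rhs => rw [h]
    congr 1
    funext i
    simp only [latPos_apply, superlatVec_apply]
    have hx := (mem_halfOpenBox.1 x.2) i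
    have h0 : (0 : ℤ) < (q i : ℤ) + 1 := by positivity
    rw [Int.toNat_of_nonneg (Int.ediv_nonneg hx.1 h0.le)]

/-- **Sums over an aligned box split over cell points and superlattice points**: `Σ_{x ∈ [0,N)^d} f x = Σ_c Σ_k f(pos c + latPos k)`.
[cite: ArakiMoriya2003, §4.1] -/
theorem sum_halfOpenBox_eq_sum_sum (f : Site d → ℝ) :
    ∑ x ∈ halfOpenBox d N, f x = ∑ c : Cell q, ∑ k : latCell q N, f (cellPos c + latPos q N k) := by
  rw [← Finset.sum_coe_sort (halfOpenBox d N), ← Fintype.sum_prod_type', ← (cellLatEquiv q hN hNq).sum_comp]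
  rfl

/-- `|Cell q| · |latCell q N| = N^d` for an aligned `N`. [cite: ArakiMoriya2003, §4.1] -/
theorem card_cell_mul_card_latCell : Fintype.card (Cell q) * Fintype.card (latCell q N) = N ^ d := by
  have h2 : Fintype.card (latCell q N) = ∏ i, (N / (q i + 1)) := by
    rw [Fintype.card_pi]; exact Finset.prod_congr rfl fun i _ => by rw [Fintype.card_fin, div_sub_one_add_one q hN hNq i]
  rw [mul_comm, h2]
  exact prod_div_mul_card_cell q hNq

end Aligned

/-! ### §2. The periodic trial state -/

section Trial

variable (q : Fin d → ℕ) (N : ℕ) (hN : 1 ≤ N) (hNq : ∀ i, (q i + 1) ∣ N) (ρ₀ : FermionOp (halfOpenBox d N))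
  (hev : parityAut ρ₀ = ρ₀) (hpsd : ρ₀.PosSemidef) (htr : ρ₀.trace = 1)

/-- **THE PERIODIC TRIAL STATE**: the average of the tiling state `⊗_v ρ₀` (box side `N`, a multiple of the periods) over the superlattice points of
`[0,N)^d` — a `q`-periodic state with the entropy of the tiling state and the cell energy of the box. [cite: BratteliRobinsonII1997, Thm. 6.2.40] -/
def perTrialState : InfVolFermionState d :=
  (boxTilingState N hN ρ₀ hev hpsd htr).shiftAverage (latPos q N)

/-- Unfolding. [cite: BratteliRobinsonII1997, Thm. 6.2.40] -/
theorem perTrialState_def : perTrialState q N hN ρ₀ hev hpsd htr = (boxTilingState N hN ρ₀ hev hpsd htr).shiftAverage (latPos q N) := rfl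

/-- `superlatVec q (e_i) = (q_i+1) e_i`. [cite: ArakiMoriya2003, §4.1] -/
theorem superlatVec_unitVec (i : Fin d) : superlatVec q (unitVec i : Site d) = periodVec q i := by
  funext j
  rw [superlatVec_apply, periodVec]
  by_cases hj : j = i
  · subst hj; simp only [unitVec, Pi.single_eq_same, one_mul]
  · simp only [unitVec, Pi.single_eq_of_ne hj, zero_mul]

include hN hNq in
/-- For an aligned `N`: `superlatVec q` of the period vector of `latCell` is the period `N e_i` of the tiling state. [cite: ArakiMoriya2003, §4.1] -/
theorem superlatVec_periodVec_latCell (i : Fin d) :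
    superlatVec q (periodVec (fun j => N / (q j + 1) - 1) i) = periodVec (fun _ : Fin d => N - 1) i := by
  funext j
  rw [superlatVec_apply, periodVec, periodVec]
  by_cases hj : j = i
  · subst hj
    rw [Pi.single_eq_same, Pi.single_eq_same]
    have h1 := div_sub_one_add_one q hN hNq j
    obtain ⟨m, hm⟩ := hNq j
    have hq : N / (q j + 1) = m := by rw [hm, Nat.mul_div_cancel_left m (Nat.succ_pos _)]
    have : ((N / (q j + 1) - 1 : ℕ) : ℤ) + 1 = m := by rw [← hq]; exact_mod_cast h1
    rw [this, Nat.cast_sub hN, Nat.cast_one, sub_add_cancel, hm]; push_cast; ring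
  · rw [Pi.single_eq_of_ne hj, Pi.single_eq_of_ne hj, zero_mul]

include hNq in
/-- **THE PERIODIC TRIAL STATE IS `q`-PERIODIC** (a period vector rotates the superlattice points of the box, the wrap-around being absorbed by the
`Nℤ^d`-periodicity of the tiling state). [cite: BratteliRobinsonII1997, Thm. 6.2.40] [cite: ArakiMoriya2003, §4.1 Def. 4.5] -/
theorem perTrialState_isPeriodic : (perTrialState q N hN ρ₀ hev hpsd htr).IsPeriodic q := by
  intro i
  set ν := boxTilingState N hN ρ₀ hev hpsd htr with hν
  have hνper : ν.IsPeriodic (fun _ : Fin d => N - 1) := boxTilingState_isPeriodic N hN ρ₀ hev hpsd htr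
  rw [perTrialState_def, ← hν, shift_shiftAverage]
  refine InfVolFermionState.ext fun Λ => LinearMap.ext fun A => ?_
  rw [shiftAverage_expect, shiftAverage_expect]
  refine congrArg _ ?_
  set q' : Fin d → ℕ := fun j => N / (q j + 1) - 1 with hq'
  have hterm : ∀ k : latCell q N, ((ν.shift (periodVec q i)).shift (latPos q N k)).expect Λ A =
      (ν.shift (latPos q N (cellRotate q' i k))).expect Λ A := by
    intro k
    rw [shift_shift]
    have hrot := cellPos_cellRotate_add q' i k
    have h2 : latPos q N (cellRotate q' i k) + (if k i = Fin.last (q' i) then periodVec (fun _ : Fin d => N - 1) i else 0) =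
        latPos q N k + periodVec q i := by
      have h3 := congrArg (superlatVec q) hrot
      rw [superlatVec_add, superlatVec_add, superlatVec_unitVec] at h3
      rw [latPos, latPos, ← h3]
      congr 1
      by_cases hl : k i = Fin.last (q' i)
      · rw [if_pos hl, if_pos hl, superlatVec_periodVec_latCell q N hN hNq]
      · rw [if_neg hl, if_neg hl, superlatVec_zero]
    rw [← h2]
    by_cases hl : k i = Fin.last (q' i)
    · rw [if_pos hl, hνper.shift_add_periodVec]
    · rw [if_neg hl, add_zero]
  simp only [hterm]
  exact (cellRotate q' i).sum_comp (fun k => (ν.shift (latPos q N k)).expect Λ A)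

/-! ### §3. Its mean entropy -/

include hNq in
/-- **Box entropies of the periodic trial state**: `(k−1)^d S(ρ₀) ≤ S(ω̃|_{[0,kN)^d})` (`ρ₀` faithful). [cite: BratteliRobinsonII1997, Thm. 6.2.40] -/
theorem pow_mul_le_vonNeumannEntropy_rdm_perTrialState (hpd : ρ₀.PosDef) {k : ℕ} (hk : 1 ≤ k) :
    ((k : ℝ) - 1) ^ d * vonNeumannEntropy ρ₀ ≤
      vonNeumannEntropy ((perTrialState q N hN ρ₀ hev hpd.posSemidef htr).rdm (halfOpenBox d (k * N))) := by
  rw [perTrialState_def]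
  refine le_trans ?_ (le_vonNeumannEntropy_rdm_shiftAverage _ _ _)
  have hcard : (Fintype.card (latCell q N) : ℝ) ≠ 0 := Nat.cast_ne_zero.2 Fintype.card_ne_zero
  have hterm : ∀ c : latCell q N, ((k : ℝ) - 1) ^ d * vonNeumannEntropy ρ₀ ≤
      vonNeumannEntropy (((boxTilingState N hN ρ₀ hev hpd.posSemidef htr).shift (latPos q N c)).rdm (halfOpenBox d (k * N))) := by
    intro c
    rw [vonNeumannEntropy_rdm_shift]
    exact pow_mul_le_vonNeumannEntropy_rdm_boxTilingState_shiftSet N hN ρ₀ hev hpd htr hk (latPos_mem_halfOpenBox q hN hNq c)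
  calc ((k : ℝ) - 1) ^ d * vonNeumannEntropy ρ₀
      = (Fintype.card (latCell q N) : ℝ)⁻¹ * ∑ _c : latCell q N, ((k : ℝ) - 1) ^ d * vonNeumannEntropy ρ₀ := by
        rw [Finset.sum_const, Finset.card_univ, nsmul_eq_mul, ← mul_assoc, inv_mul_cancel₀ hcard, one_mul]
    _ ≤ _ := mul_le_mul_of_nonneg_left (Finset.sum_le_sum fun c _ => hterm c) (inv_nonneg.2 (Nat.cast_nonneg _))

/-- `((k−1)/k)^d → 1` (re-derived). [folklore] -/
private theorem tendsto_sub_one_div_pow' : Tendsto (fun k : ℕ => (((k : ℝ) - 1) / k) ^ d) atTop (𝓝 1) := by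
  have h1 : Tendsto (fun k : ℕ => ((k : ℝ) - 1) / k) atTop (𝓝 1) := by
    have : Tendsto (fun k : ℕ => 1 - (1 : ℝ) / k) atTop (𝓝 (1 - 0)) :=
      tendsto_const_nhds.sub (tendsto_const_div_atTop_nhds_zero_nat _)
    rw [sub_zero] at this
    refine this.congr' ?_
    filter_upwards [Filter.eventually_ge_atTop 1] with k hk
    have hk0 : (k : ℝ) ≠ 0 := by exact_mod_cast (by omega : k ≠ 0)
    field_simp
  have h2 := h1.pow d
  rwa [one_pow] at h2

include hNq in
/-- **THE ENTROPY DENSITY OF THE PERIODIC TRIAL STATE**: `S(ρ₀)/N^d ≤ s̄(ω̃)` (`d ≥ 1`, `N` aligned, `ρ₀` faithful). [cite: BratteliRobinsonII1997, Thm. 6.2.40] -/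
theorem le_entropyDensitySup_perTrialState (hd : 0 < d) (hpd : ρ₀.PosDef) :
    vonNeumannEntropy ρ₀ / (N : ℝ) ^ d ≤ (perTrialState q N hN ρ₀ hev hpd.posSemidef htr).entropyDensitySup := by
  have hper := perTrialState_isPeriodic q N hN hNq ρ₀ hev hpd.posSemidef htr
  have hsub := hper.tendsto_boxEntropyDensity_mul hd hN hNq
  have hn0 : (0 : ℝ) < N := by exact_mod_cast hN
  have hb : Tendsto (fun k : ℕ => (((k : ℝ) - 1) / k) ^ d * (vonNeumannEntropy ρ₀ / (N : ℝ) ^ d)) atTop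
      (𝓝 (vonNeumannEntropy ρ₀ / (N : ℝ) ^ d)) := by
    have h := (tendsto_sub_one_div_pow' (d := d)).mul_const (vonNeumannEntropy ρ₀ / (N : ℝ) ^ d)
    rwa [one_mul] at h
  refine le_of_tendsto_of_tendsto hb hsub ?_
  filter_upwards [Filter.eventually_ge_atTop 1] with k hk
  have hk0 : (0 : ℝ) < k := by exact_mod_cast hk
  simp only [boxEntropyDensity_apply]
  have hkn : (0 : ℝ) < ((k * N : ℕ) : ℝ) ^ d := by positivity
  rw [le_div_iff₀ hkn]
  have h := pow_mul_le_vonNeumannEntropy_rdm_perTrialState q N hN hNq ρ₀ hev htr hpd hk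
  have e : (((k : ℝ) - 1) / k) ^ d * (vonNeumannEntropy ρ₀ / (N : ℝ) ^ d) * ((k * N : ℕ) : ℝ) ^ d = ((k : ℝ) - 1) ^ d * vonNeumannEntropy ρ₀ := by
    push_cast
    rw [div_pow, mul_pow]
    field_simp
  rw [e]
  exact h

/-! ### §4. Its cell energy density -/

variable {κ : Type} [Fintype κ] [Nonempty κ]

omit hN in
/-- **Site energies are affine**: the site energy of a translation average is the average of the translates' site energies. [cite: BratteliRobinsonI1987, §4.3.1] -/
theorem siteEnergy_shiftAverage (Ψ : FermionInteraction d) (R : ℝ) (pos : κ → Site d) (ν : InfVolFermionState d) (x : Site d) :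
    siteEnergy Ψ (ν.shiftAverage pos) R x = (((Fintype.card κ : ℝ)⁻¹ : ℝ) : ℂ) * ∑ k, siteEnergy Ψ (ν.shift (pos k)) R x := by
  simp only [siteEnergy_apply, shiftAverage_expect, Finset.mul_sum]
  rw [Finset.sum_comm]
  refine Finset.sum_congr rfl fun Y _ => Finset.sum_congr rfl fun k _ => ?_
  ring

/-- Composition of set translations (local copy). [folklore] -/
private theorem shiftSet_shiftSet₃ (a b : Site d) (A : Finset (Site d)) : shiftSet b (shiftSet a A) = shiftSet (a + b) A := by
  ext y; simp only [mem_shiftSet]; rw [show y - (a + b) = y - b - a by abel]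

omit hN in
/-- **Site energies of superlattice translates**: for a `q`-periodic `Ψ`, `ε_{ν ∘ τ_ℓ}(x) = ε_ν(x + ℓ)` for every superlattice vector `ℓ`.
[cite: ArakiMoriya2003, §4.1 Def. 4.3] -/
theorem _root_.Literature.MathematicalPhysics.QuantumLattice.FermionInteraction.IsPeriodic.siteEnergy_shift_superlatVec {Ψ : FermionInteraction d}
    (hΨ : Ψ.IsPeriodic q) (R : ℝ) (ν : InfVolFermionState d) (z : Fin d → ℤ) (x : Site d) :
    siteEnergy Ψ (ν.shift (superlatVec q z)) R x = siteEnergy Ψ ν R (x + superlatVec q z) := by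
  rw [siteEnergy_eq_sum_shiftSet, siteEnergy_eq_sum_shiftSet]
  refine Finset.sum_congr rfl fun X _ => ?_
  rw [card_shiftSet, card_shiftSet, ← shiftSet_shiftSet₃ x (superlatVec q z) X, ν.expect_apply_congr Ψ rfl, hΨ z (shiftSet x X), shift_expect]

include hNq in
/-- **`N^d ē_q(ω̃) = Σ_{x ∈ [0,N)^d} Re ε_{⊗ρ₀}(x)`**: the cell energy density of the periodic trial state is the box average of the site energies of the
tiling state (`Ψ` `q`-periodic, `N` aligned). [cite: BratteliRobinsonII1997, Thm. 6.2.40] -/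
theorem pow_mul_cellMeanEnergy_perTrialState {Ψ : FermionInteraction d} (hΨ : Ψ.IsPeriodic q) (R : ℝ) :
    (N : ℝ) ^ d * cellMeanEnergy q Ψ (perTrialState q N hN ρ₀ hev hpsd htr) R =
      ∑ x ∈ halfOpenBox d N, (siteEnergy Ψ (boxTilingState N hN ρ₀ hev hpsd htr) R x).re := by
  set ν := boxTilingState N hN ρ₀ hev hpsd htr with hν
  rw [cellMeanEnergy, sum_halfOpenBox_eq_sum_sum q hN hNq]
  have hC : (Fintype.card (Cell q) : ℝ) ≠ 0 := Nat.cast_ne_zero.2 Fintype.card_ne_zero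
  have hK : (Fintype.card (latCell q N) : ℝ) ≠ 0 := Nat.cast_ne_zero.2 Fintype.card_ne_zero
  have hNd : (N : ℝ) ^ d = (Fintype.card (Cell q) : ℝ) * Fintype.card (latCell q N) := by
    exact_mod_cast (card_cell_mul_card_latCell q hN hNq).symm
  have hsite : ∀ c : Cell q, (siteEnergy Ψ (perTrialState q N hN ρ₀ hev hpsd htr) R (cellPos c)).re =
      (Fintype.card (latCell q N) : ℝ)⁻¹ * ∑ k : latCell q N, (siteEnergy Ψ ν R (cellPos c + latPos q N k)).re := by
    intro c
    have hs : ∀ k : latCell q N, siteEnergy Ψ (ν.shift (latPos q N k)) R (cellPos c) = siteEnergy Ψ ν R (cellPos c + latPos q N k) :=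
      fun k => by rw [latPos, hΨ.siteEnergy_shift_superlatVec]
    rw [perTrialState_def, ← hν, siteEnergy_shiftAverage]
    simp only [hs, Complex.re_ofReal_mul, Complex.re_sum]
  rw [Finset.sum_congr rfl fun c _ => hsite c, ← Finset.mul_sum, ← mul_assoc, ← mul_assoc, hNd]
  have e : (Fintype.card (Cell q) : ℝ) * (Fintype.card (latCell q N) : ℝ) * (Fintype.card (Cell q) : ℝ)⁻¹ *
      (Fintype.card (latCell q N) : ℝ)⁻¹ = 1 := by
    field_simp
  rw [e, one_mul]

include hNq in
/-- **THE CELL ENERGY DENSITY OF THE PERIODIC TRIAL STATE**: for `Ψ` `q`-periodic of finite range `R` with uniform site norm `S` and `N` aligned,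
`|N^d ē_q(ω̃) − (Re tr(H_{[0,N)^d} ρ₀) − Re(Ψ∅)_{∅∅})| ≤ col_R(N) · S`. [cite: BratteliRobinsonII1997, Thm. 6.2.40]
[cite: BratteliKishimotoRobinson1978, §3 (H̃_Φ(Λ), W_Φ(Λ), p. 47)] -/
theorem abs_pow_mul_cellMeanEnergy_perTrialState_sub_le {Ψ : FermionInteraction d} (hΨ : Ψ.IsPeriodic q) {R S : ℝ} (hR : Ψ.HasFiniteRange R)
    (hS : ∀ y : Site d, ∑ X ∈ (thicken ({y} : Finset (Site d)) R).powerset with y ∈ X, ‖Ψ.Φ X‖ ≤ S) :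
    |(N : ℝ) ^ d * cellMeanEnergy q Ψ (perTrialState q N hN ρ₀ hev hpsd htr) R -
        ((Ψ.localHamiltonian (halfOpenBox d N) * ρ₀).trace.re - ((Ψ.Φ ∅) ∅ ∅).re)| ≤
      ((thicken (halfOpenBox d N) R \ halfOpenBox d N).card : ℝ) * S := by
  set ν := boxTilingState N hN ρ₀ hev hpsd htr with hν
  rw [pow_mul_cellMeanEnergy_perTrialState q N hN hNq ρ₀ hev hpsd htr hΨ R, ← hν]
  have h := ν.norm_sum_siteEnergy_sub_le Ψ hR hS (halfOpenBox d N)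
  have hH : ν.expect (halfOpenBox d N) (Ψ.localHamiltonian (halfOpenBox d N)) = (Ψ.localHamiltonian (halfOpenBox d N) * ρ₀).trace :=
    boxTilingState_expect_box_zero N hN ρ₀ hev hpsd htr _
  rw [hH, expect_empty_eq] at h
  rw [← Complex.re_sum]
  refine le_trans ?_ h
  rw [← Complex.sub_re, ← Complex.sub_re]
  exact Complex.abs_re_le_norm _

end Trial

end InfVolFermionState

end Literature.MathematicalPhysics.QuantumLattice

end
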